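import Mathlib
import Literature.Probability.RandomPlanarGeometry.HexParafermionProofs

/-!
# Slitting a simply connected hexagonal domain along a walk keeps it simply connected

Helper file for the crux `NoFoldBound` (stmt-CriticalPhenomena-8296) of the route
`SAWDevelopingMap` (sub-problem `SAWScalingLimit` of `CriticalPhenomena`), line `Ideator3Sketch`,
leaf `stub_slitSC`.

Setting (Duminil-Copin–Smirnov 2012, §2): a finite vertex set `Λ` of the hexagonal lattice `ℍ`
(`hexGraph`) is *simply connected* when the subgraph of `ℍ` induced on the complement `Λᶜ` is
preconnected (`hexDomainSimplyConnected`).  For a boundary mid-edge `a = {u, w₁}` (`u ∉ Λ ∋ w₁`,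
`a ∈ hexDomainBoundary Λ`) and a self-avoiding walk `γ : a → z` of the domain
(`HexMidEdgeSAW Λ a z`, visiting the vertices `γ.verts = [w₁, …, wₙ]` of `Λ` in order), the slit
domain `Λ ∖ {w₁, …, wₙ}` is again simply connected (`stub_slitSC`).

## Proof

The complement of the slit domain is `Λᶜ ∪ {w₁, …, wₙ}`.  It is obtained from the preconnected
set `Λᶜ` by attaching the chain of adjacent vertices `u ∼ w₁ ∼ w₂ ∼ ⋯ ∼ wₙ` at its first vertex
`u ∈ Λᶜ` (`u ∼ w₁` because `a` is an edge of `ℍ`, `w₁` is the first vertex of `γ` because the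
other endpoint `u` of `a` is not in `Λ`, and consecutive vertices of `γ` are adjacent), one vertex
at a time: adding to a preconnected induced subgraph a vertex adjacent to one of its vertices
keeps it preconnected (Mathlib's `SimpleGraph.connected_induce_union`); this is the generic
`preconnected_induce_union_of_isChain`, an induction along the list.

No new definitions; every declaration is proved.
-/

noncomputable section

open Literature.Probability.LatticeModels Literature.Probability.RandomPlanarGeometry.SAW

namespace Summit.CriticalPhenomena.SAWScalingLimit.Theorems.SAWDevelopingMapNoFoldBound

/-- **Attaching a chain to a preconnected induced subgraph.** If the subgraph of `G` induced on
`s` is preconnected, `v ∈ s`, and `v :: l` is a chain of `G`-adjacent vertices, then the subgraph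
induced on `s ∪ {x | x ∈ l}` is preconnected: induction on `l`, the head `w` of `l = w :: l'`
being attached to `s` through the edge `v w` (`SimpleGraph.connected_induce_union`), after which
`w :: l'` is a chain starting in `s ∪ {w}`. [folklore] -/
theorem preconnected_induce_union_of_isChain {V : Type*} {G : SimpleGraph V} :
    ∀ (l : List V) (s : Set V) (v : V), (G.induce s).Preconnected → v ∈ s →
      List.IsChain G.Adj (v :: l) → (G.induce (s ∪ {x | x ∈ l})).Preconnected
  | [], s, _, hs, _, _ => by
    have hset : s ∪ {x | x ∈ ([] : List V)} = s := by
      ext x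
      simp
    rw [hset]
    exact hs
  | w :: l, s, v, hs, hv, hc => by
    obtain ⟨hvw, hc'⟩ := List.isChain_cons_cons.1 hc
    have ht : (G.induce ({w} : Set V)).Preconnected := by
      rw [SimpleGraph.induce_singleton_eq_top]
      exact SimpleGraph.preconnected_top
    have h₁ : (G.induce (s ∪ {w})).Preconnected :=
      (SimpleGraph.connected_induce_union hs ht hv rfl hvw).preconnected
    have h₂ := preconnected_induce_union_of_isChain l (s ∪ {w}) w h₁ (Or.inr rfl) hc'
    have hset : s ∪ {x | x ∈ w :: l} = s ∪ {w} ∪ {x | x ∈ l} := by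
      ext x
      simp only [Set.mem_union, Set.mem_setOf_eq, List.mem_cons, Set.mem_singleton_iff, or_assoc]
    rw [hset]
    exact h₂

/-- **Slitting keeps the complement connected** (leaf `stub_slitSC` of the crux `NoFoldBound`).
If the finite vertex set `Λ ⊂ ℍ` has a connected complement, `a ∈ ∂Ω` is a boundary mid-edge and
`γ : a → z` is a self-avoiding walk of the domain, then `Λ ∖ γ.verts` has a connected complement:
`(Λ ∖ γ.verts)ᶜ = Λᶜ ∪ γ.verts`, and the vertices of `γ` form a chain of adjacent vertices whose
first vertex `w₁` is adjacent to the outer endpoint `u ∉ Λ` of `a = {u, w₁}`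
(`preconnected_induce_union_of_isChain`). [folklore] -/
theorem stub_slitSC :
    ∀ (Λ : Finset HexVertex), hexDomainSimplyConnected Λ → ∀ a ∈ hexDomainBoundary Λ,
      ∀ (z : Sym2 HexVertex) (γ : HexMidEdgeSAW Λ a z),
        hexDomainSimplyConnected (Λ \ γ.verts.toFinset) := by
  intro Λ hΛ a ha z γ
  obtain ⟨he, u, w₁, rfl, -, hu⟩ := ha
  unfold hexDomainSimplyConnected at hΛ ⊢
  have hset : ((↑(Λ \ γ.verts.toFinset) : Set HexVertex)ᶜ) =
      (↑Λ : Set HexVertex)ᶜ ∪ {x | x ∈ γ.verts} := by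
    ext f
    simp only [Finset.coe_sdiff, List.coe_toFinset, Set.mem_compl_iff, Set.mem_sdiff,
      Finset.mem_coe, Set.mem_setOf_eq, Set.mem_union]
    tauto
  rw [hset]
  refine preconnected_induce_union_of_isChain γ.verts _ u hΛ hu ?_
  rcases hγ : γ.verts with _ | ⟨w, l⟩
  · exact List.IsChain.singleton u
  · -- the first vertex is `w₁`, adjacent to `u`
    have hne : γ.verts ≠ [] := by rw [hγ]; exact List.cons_ne_nil w l
    have hw : w = w₁ := by
      have h := γ.head_eq rfl hu hne
      rw [List.head_eq_iff_head?_eq_some, hγ] at h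
      simpa using h
    have hadj : hexGraph.Adj u w := hw ▸ (SimpleGraph.mem_edgeSet hexGraph).1 he
    exact List.IsChain.cons_cons hadj (hγ ▸ γ.isChain)

end Summit.CriticalPhenomena.SAWScalingLimit.Theorems.SAWDevelopingMapNoFoldBound
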